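import Summits.Ventures.PercRepro.Night2StarTwoLong

/-!
# PercRepro — night-2: `(★)` in the count of long circuits, and the «one long circuit» case (blind cell pub-perc-repro, night-2 gen 1)

`longPts M G B q = {x ∈ G ∖ B : m(B ∪ {x}) + 8 ≤ q}` counts the fundamental circuits of `B` with `≥ 9` points. Over
`Night2StarTwoLong` / `Night2StarSmall`:
* `rec_ge_of_two_le_longPts` (`|G| ≥ q + 4`), `rec_ge_of_three_le_longPts`, **`starCharge_of_forall_two_le_longPts`**,
  **`Jq_two_nonneg_of_forall_two_le_longPts`** — the type-`2` balance on every rank-`q` set of corank `≥ 4` all of whose bases have two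
  long fundamental circuits;
* `small_budget_one` (a point against ONE long point: single + pair `≥ (2/9)/(q + 1)`), **`rec_ge_of_one_long`** — ONE LONG CIRCUIT,
  CORANK `≥ 7` (Proposition 4.4 of the paper, «Proposition 10» on the bus): one long point and six further points of `G ∖ B` suffice
  (`2/3 + 6·(2/9) = 2`); `rec_ge_of_one_le_longPts`, **`Jq_two_nonneg_of_forall_one_le_longPts`** (`|G| ≥ q + 7`).
So at corank `≥ 7` the type-`2` balance can only fail at a basis ALL of whose fundamental circuits have `≤ 8` points.
-/

namespace PercRepro.Star

open Finset ThmH SixFour GenQ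

variable {α : Type*} [DecidableEq α] {M : Matroid α} [M.Finite]

/-! ## In the form of a count of long circuits -/

/-- The points `x` of `G ∖ B` whose fundamental circuit is long: `m(B ∪ {x}) + 8 ≤ q` (`≥ 9` points). -/
noncomputable def longPts (M : Matroid α) [M.Finite] (G B : Finset α) (q : ℕ) : Finset α :=
  (G \ B).filter (fun x => mTr M (insert x B) + 8 ≤ q)

/-- A basis with at least two long fundamental circuits in a set of corank `≥ 4` receives `≥ 2/(q + 1)`. -/
theorem rec_ge_of_two_le_longPts (hs : Simple M) {G B : Finset α} {q : ℕ} (hG : G ⊆ gr M)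
    (hrG : M.eRk (G : Set α) = (q : ℕ∞)) (hB : B ∈ Bq M G q) (hq : 1 ≤ q) (hcard : q + 4 ≤ G.card)
    (hlong : 2 ≤ (longPts M G B q).card) : 2 / ((q : ℚ) + 1) ≤ rec M G q B := by
  obtain ⟨u, hu, v, hv, huv⟩ := Finset.one_lt_card.1 hlong
  unfold longPts at hu hv
  rw [Finset.mem_filter] at hu hv
  have hGB : 4 ≤ (G \ B).card := by
    rw [Finset.card_sdiff_of_subset (mem_Bq.1 hB).1, (mem_Bq.1 hB).2.2]
    omega
  have hR : 2 ≤ (((G \ B).erase u).erase v).card := by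
    have h1 := Finset.card_erase_add_one (Finset.mem_erase.2 ⟨Ne.symm huv, hv.1⟩)
    have h2 := Finset.card_erase_add_one hu.1
    omega
  obtain ⟨i, hi, j, hj, hij⟩ := Finset.one_lt_card.1 hR
  rw [Finset.mem_erase, Finset.mem_erase] at hi hj
  exact rec_ge_of_two_long hs hG hrG hB hq hu.1 hv.1 hi.2.2 hj.2.2 huv (Ne.symm hi.2.1) (Ne.symm hj.2.1)
    (Ne.symm hi.1) (Ne.symm hj.1) hij hu.2 hv.2

/-- A basis with at least three long fundamental circuits receives `≥ 2/(q + 1)`. -/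
theorem rec_ge_of_three_le_longPts (hs : Simple M) {G B : Finset α} {q : ℕ} (hG : G ⊆ gr M)
    (hrG : M.eRk (G : Set α) = (q : ℕ∞)) (hB : B ∈ Bq M G q)
    (hlong : 3 ≤ (longPts M G B q).card) : 2 / ((q : ℚ) + 1) ≤ rec M G q B := by
  obtain ⟨x, hx, y, hy, hxy⟩ := Finset.one_lt_card.1 (by omega : 1 < (longPts M G B q).card)
  have hR : 1 ≤ (((longPts M G B q).erase x).erase y).card := by
    have h1 := Finset.card_erase_add_one (Finset.mem_erase.2 ⟨Ne.symm hxy, hy⟩)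
    have h2 := Finset.card_erase_add_one hx
    omega
  obtain ⟨z, hz⟩ := Finset.card_pos.1 hR
  rw [Finset.mem_erase, Finset.mem_erase] at hz
  unfold longPts at hx hy hz
  rw [Finset.mem_filter] at hx hy
  rw [Finset.mem_filter] at hz
  exact rec_ge_of_three_long hs hG hrG hB hx.1 hy.1 hz.2.2.1 hxy (Ne.symm hz.2.1) (Ne.symm hz.1) hx.2 hy.2 hz.2.2.2

/-- **`(★)` when every basis has two long fundamental circuits (corank `≥ 4`)**, hence the type-`2` balance. -/
theorem starCharge_of_forall_two_le_longPts (hs : Simple M) {G : Finset α} {q : ℕ} (hG : G ⊆ gr M)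
    (hrG : M.eRk (G : Set α) = (q : ℕ∞)) (hq : 1 ≤ q) (hcard : q + 4 ≤ G.card)
    (hlong : ∀ B ∈ Bq M G q, 2 ≤ (longPts M G B q).card) : StarCharge M G q :=
  fun B hB _ => rec_ge_of_two_le_longPts hs hG hrG hB hq hcard (hlong B hB)

/-- The type-`2` balance holds on every rank-`q` set of corank `≥ 4` all of whose bases have two long fundamental
circuits. -/
theorem Jq_two_nonneg_of_forall_two_le_longPts (hs : Simple M) {G : Finset α} {q : ℕ} (hG : G ⊆ gr M)
    (hrG : M.eRk (G : Set α) = (q : ℕ∞)) (hq : 1 ≤ q) (hcard : q + 4 ≤ G.card)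
    (hlong : ∀ B ∈ Bq M G q, 2 ≤ (longPts M G B q).card) : 0 ≤ Jq M G q 2 :=
  Jq_two_nonneg_of_star hs hG hrG (starCharge_of_forall_two_le_longPts hs hG hrG hq hcard hlong)

/-! ## One long circuit and corank `≥ 7` -/

/-- The budget of one point `i` against ONE long point `w`: its single and its pair with `w` pay together
`≥ (2/9)/(q + 1)` (indeed `(1 − 7/(3c_i))/(q + 1)`). -/
theorem small_budget_one (hs : Simple M) {G B : Finset α} {q : ℕ} (hG : G ⊆ gr M)
    (hrG : M.eRk (G : Set α) = (q : ℕ∞)) (hB : B ∈ Bq M G q) (hq : 1 ≤ q) {i w : α} (hi : i ∈ G \ B)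
    (hw : w ∈ G \ B) (hiw : i ≠ w) (hmw : mTr M (insert w B) + 8 ≤ q) :
    (2 / 9) / ((q : ℚ) + 1) ≤ surplus M G q (insert i B) / (bIn M G q (insert i B) : ℚ) +
      surplus M G q (insert i (insert w B)) / (bIn M G q (insert i (insert w B)) : ℚ) := by
  obtain ⟨hSi, hci⟩ := insert_mem_SNq hrG hB hi
  have hmi := mTr_add_two_le_of_spanning_nonbasis hs ((mem_SNq.1 hSi).1.trans hG) (mem_SNq.1 hSi).2.1 hq
    (by omega)
  have h1 := single_term_ge hs hG (mem_SNq.1 hSi).1 (mem_SNq.1 hSi).2.1 hq hci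
  have h2 := pair_term_ge hs hG hrG hB hq hi hw hiw
  set mi : ℚ := (mTr M (insert i B) : ℚ) with hmi_def
  set mw : ℚ := (mTr M (insert w B) : ℚ) with hmw_def
  have hmi0 : (0 : ℚ) ≤ mi := by rw [hmi_def]; positivity
  have hmw0 : (0 : ℚ) ≤ mw := by rw [hmw_def]; positivity
  have hmiq : mi + 2 ≤ q := by rw [hmi_def]; exact_mod_cast hmi
  have hmwq : mw + 8 ≤ q := by rw [hmw_def]; exact_mod_cast hmw
  have ha := single_arith hmi0 hmiq
  have hbw := long_arith hmw0 hmwq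
  have hq1 : (0 : ℚ) < (q : ℚ) + 1 := by positivity
  have hc : (0 : ℚ) < (q : ℚ) + 1 - mi := by linarith
  have hpw : (2 / (3 * ((q : ℚ) + 1))) / ((q : ℚ) + 1 - mi) ≤
      ((q : ℚ) / (1 + mw) - ((q : ℚ) + 2) / ((q : ℚ) + 1)) / (((q : ℚ) + 1 - mi) * ((q : ℚ) + 1 - mw)) := by
    calc (2 / (3 * ((q : ℚ) + 1))) / ((q : ℚ) + 1 - mi)
        ≤ ((q : ℚ) / (1 + mw) - ((q : ℚ) + 2) / ((q : ℚ) + 1)) / ((q : ℚ) + 1 - mw) / ((q : ℚ) + 1 - mi) :=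
          div_le_div_of_nonneg_right hbw hc.le
      _ = ((q : ℚ) / (1 + mw) - ((q : ℚ) + 2) / ((q : ℚ) + 1)) / (((q : ℚ) + 1 - mi) * ((q : ℚ) + 1 - mw)) := by
          rw [div_div]; ring
  set c : ℚ := (q : ℚ) + 1 - mi with hc_def
  have hc3 : (3 : ℚ) ≤ c := by rw [hc_def]; linarith
  have e1 : (2 / (3 * ((q : ℚ) + 1))) / c = (2 / 3) / (c * ((q : ℚ) + 1)) := by
    field_simp
  have hkey : (2 / 9) / ((q : ℚ) + 1) ≤ (c - 3) / (c * ((q : ℚ) + 1)) + (2 / 3) / (c * ((q : ℚ) + 1)) := by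
    rw [← add_div, div_le_div_iff₀ hq1 (by positivity)]
    nlinarith [mul_nonneg (sub_nonneg.2 hc3) hq1.le]
  linarith

/-- **One long circuit, corank `≥ 7`**: a basis `B` of `G` with a point `w ∈ G ∖ B` whose single has at most
`q − 8` coloops, and a set `P` of at least six further points of `G ∖ B`, receives `rec(B) ≥ 2/(q + 1)`. -/
theorem rec_ge_of_one_long (hs : Simple M) {G B : Finset α} {q : ℕ} (hG : G ⊆ gr M)
    (hrG : M.eRk (G : Set α) = (q : ℕ∞)) (hB : B ∈ Bq M G q) (hq : 1 ≤ q) {w : α} (hw : w ∈ G \ B)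
    (hmw : mTr M (insert w B) + 8 ≤ q) {P : Finset α} (hP : P ⊆ (G \ B).erase w) (hP6 : 6 ≤ P.card) :
    2 / ((q : ℚ) + 1) ≤ rec M G q B := by
  have hwB := (Finset.mem_sdiff.1 hw).2
  have hPmem : ∀ i ∈ P, i ∈ G \ B ∧ i ≠ w := fun i hi => by
    have := Finset.mem_erase.1 (hP hi)
    exact ⟨this.2, this.1⟩
  set f : Finset α → ℚ := fun S => surplus M G q S / (bIn M G q S : ℚ) with hf
  have hf0 : ∀ S ∈ (SNq M G q).filter (fun S : Finset α => B ⊆ S), 0 ≤ f S := by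
    intro S hS
    have hS' := (Finset.mem_filter.1 hS).1
    apply div_nonneg (surplus_nonneg hs hG hrG hS')
    positivity
  -- the singles of `P`
  set T1 : Finset (Finset α) := P.image (fun a => insert a B) with hT1
  have hT1sub : T1 ⊆ (SNq M G q).filter (fun S : Finset α => B ⊆ S) := by
    intro S hS
    rw [hT1, Finset.mem_image] at hS
    obtain ⟨a, ha, rfl⟩ := hS
    exact Finset.mem_filter.2 ⟨(insert_mem_SNq hrG hB (hPmem a ha).1).1, Finset.subset_insert a B⟩
  have hsum1 : ∑ S ∈ T1, f S = ∑ a ∈ P, f (insert a B) := by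
    rw [hT1, Finset.sum_image]
    intro a ha b _ hab
    exact eq_of_insert_eq (Finset.mem_sdiff.1 (hPmem a (Finset.mem_coe.1 ha)).1).2 hab
  -- the pairs of `P` with `w`
  set T2 : Finset (Finset α) := P.image (fun a => insert a (insert w B)) with hT2
  have hT2sub : T2 ⊆ (SNq M G q).filter (fun S : Finset α => B ⊆ S) := by
    intro S hS
    rw [hT2, Finset.mem_image] at hS
    obtain ⟨a, ha, rfl⟩ := hS
    exact Finset.mem_filter.2 ⟨(insert_insert_mem_SNq hrG hB (hPmem a ha).1 hw (hPmem a ha).2).1,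
      (Finset.subset_insert w B).trans (Finset.subset_insert a _)⟩
  have hsum2 : ∑ S ∈ T2, f S = ∑ a ∈ P, f (insert a (insert w B)) := by
    rw [hT2, Finset.sum_image]
    intro a ha b _ hab
    have haB : a ∉ insert w B := by
      rw [Finset.mem_insert, not_or]
      exact ⟨(hPmem a (Finset.mem_coe.1 ha)).2, (Finset.mem_sdiff.1 (hPmem a (Finset.mem_coe.1 ha)).1).2⟩
    exact eq_of_insert_eq haB hab
  -- the long single
  have hwS : insert w B ∈ (SNq M G q).filter (fun S : Finset α => B ⊆ S) :=
    Finset.mem_filter.2 ⟨(insert_mem_SNq hrG hB hw).1, Finset.subset_insert w B⟩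
  have hwT1 : insert w B ∉ T1 := by
    intro h
    rw [hT1, Finset.mem_image] at h
    obtain ⟨a, ha, hab⟩ := h
    exact (hPmem a ha).2 (eq_of_insert_eq (Finset.mem_sdiff.1 (hPmem a ha).1).2 hab)
  have hwT2 : insert w B ∉ T2 := by
    intro h
    rw [hT2, Finset.mem_image] at h
    obtain ⟨a, ha, hab⟩ := h
    have h1 := congrArg Finset.card hab
    have haB : a ∉ insert w B := by
      rw [Finset.mem_insert, not_or]
      exact ⟨(hPmem a ha).2, (Finset.mem_sdiff.1 (hPmem a ha).1).2⟩
    rw [Finset.card_insert_of_notMem haB, Finset.card_insert_of_notMem hwB] at h1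
    omega
  have hdisj : Disjoint T1 T2 := by
    rw [Finset.disjoint_left]
    intro S hS1 hS2
    rw [hT1, Finset.mem_image] at hS1
    rw [hT2, Finset.mem_image] at hS2
    obtain ⟨a, ha, rfl⟩ := hS1
    obtain ⟨b, hb, hab⟩ := hS2
    have h1 := congrArg Finset.card hab
    have hbB : b ∉ insert w B := by
      rw [Finset.mem_insert, not_or]
      exact ⟨(hPmem b hb).2, (Finset.mem_sdiff.1 (hPmem b hb).1).2⟩
    rw [Finset.card_insert_of_notMem hbB, Finset.card_insert_of_notMem hwB,
      Finset.card_insert_of_notMem (Finset.mem_sdiff.1 (hPmem a ha).1).2] at h1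
    omega
  have hrec : ∑ S ∈ insert (insert w B) (T1 ∪ T2), f S ≤ rec M G q B := by
    unfold rec
    apply Finset.sum_le_sum_of_subset_of_nonneg
    · exact Finset.insert_subset hwS (Finset.union_subset hT1sub hT2sub)
    · intro S hS _
      exact hf0 S hS
  rw [Finset.sum_insert (by rw [Finset.mem_union, not_or]; exact ⟨hwT1, hwT2⟩), Finset.sum_union hdisj, hsum1,
    hsum2, ← Finset.sum_add_distrib] at hrec
  -- the long single pays `2/3`, every point of `P` pays `2/9`
  obtain ⟨hSw, hcw⟩ := insert_mem_SNq hrG hB hw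
  have hLw := surplus_div_bIn_ge_of_long hG (mem_SNq.1 hSw).1 (mem_SNq.1 hSw).2.1 hcw hmw
  have hP' : ∀ a ∈ P, (2 / 9) / ((q : ℚ) + 1) ≤ f (insert a B) + f (insert a (insert w B)) := fun a ha =>
    small_budget_one hs hG hrG hB hq (hPmem a ha).1 hw (hPmem a ha).2 hmw
  have hsumP : P.card • ((2 / 9) / ((q : ℚ) + 1)) ≤ ∑ a ∈ P, (f (insert a B) + f (insert a (insert w B))) :=
    Finset.card_nsmul_le_sum P _ _ hP'
  have hq1 : (0 : ℚ) < (q : ℚ) + 1 := by positivity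
  have hP6' : (6 : ℚ) ≤ P.card := by exact_mod_cast hP6
  have hkey : 2 / ((q : ℚ) + 1) ≤ 2 / (3 * ((q : ℚ) + 1)) + 6 * ((2 / 9) / ((q : ℚ) + 1)) := by
    rw [div_le_iff₀ hq1]
    field_simp
    ring_nf
    nlinarith
  have hsmul : (P.card : ℚ) * ((2 / 9) / ((q : ℚ) + 1)) ≤
      ∑ a ∈ P, (f (insert a B) + f (insert a (insert w B))) := by
    rw [← nsmul_eq_mul]
    exact hsumP
  have h6 : 6 * ((2 / 9) / ((q : ℚ) + 1)) ≤ (P.card : ℚ) * ((2 / 9) / ((q : ℚ) + 1)) := by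
    apply mul_le_mul_of_nonneg_right hP6'
    positivity
  simp only [hf] at hrec hsmul
  linarith

/-- A basis with one long fundamental circuit in a set of corank `≥ 7` receives `≥ 2/(q + 1)`. -/
theorem rec_ge_of_one_le_longPts (hs : Simple M) {G B : Finset α} {q : ℕ} (hG : G ⊆ gr M)
    (hrG : M.eRk (G : Set α) = (q : ℕ∞)) (hB : B ∈ Bq M G q) (hq : 1 ≤ q) (hcard : q + 7 ≤ G.card)
    (hlong : 1 ≤ (longPts M G B q).card) : 2 / ((q : ℚ) + 1) ≤ rec M G q B := by
  obtain ⟨w, hw⟩ := Finset.card_pos.1 hlong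
  unfold longPts at hw
  rw [Finset.mem_filter] at hw
  have hGB : 7 ≤ (G \ B).card := by
    rw [Finset.card_sdiff_of_subset (mem_Bq.1 hB).1, (mem_Bq.1 hB).2.2]
    omega
  have hR : 6 ≤ ((G \ B).erase w).card := by
    have := Finset.card_erase_add_one hw.1
    omega
  exact rec_ge_of_one_long hs hG hrG hB hq hw.1 hw.2 (Finset.Subset.refl _) hR

/-- **The kernel residue of `(★)` at corank `≥ 7`**: if every basis of `G` has at least one long fundamental circuit
(`≥ 9` points), the type-`2` balance holds. -/
theorem Jq_two_nonneg_of_forall_one_le_longPts (hs : Simple M) {G : Finset α} {q : ℕ} (hG : G ⊆ gr M)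
    (hrG : M.eRk (G : Set α) = (q : ℕ∞)) (hq : 1 ≤ q) (hcard : q + 7 ≤ G.card)
    (hlong : ∀ B ∈ Bq M G q, 1 ≤ (longPts M G B q).card) : 0 ≤ Jq M G q 2 :=
  Jq_two_nonneg_of_star hs hG hrG (fun B hB _ => rec_ge_of_one_le_longPts hs hG hrG hB hq hcard (hlong B hB))


end PercRepro.Star
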